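import Literature.AlgebraicGeometry.Deformation.LocalHilbertFunctorSmallExtensionAffine
import Literature.AlgebraicGeometry.Deformation.LocalHilbertFunctorFibreTorsorGeneral
import Literature.AlgebraicGeometry.Deformation.LocalHilbertFunctorSheaf
import Literature.AlgebraicGeometry.Deformation.LocalHilbertFunctorCompleteIntersectionCharts
import HarnessLib

/-!
# Sections of the tangent sheaf of the local Hilbert functor over an affine open: `H_{Z ∩ U}^U(k[J]) ≅ Hom_A(I(U), A/I(U))`

Topic `Literature/AlgebraicGeometry/Deformation`. THEOREMS and definitions WITH BODY only (no named fact, no `sorry`,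
no instance, no notation). Written for the literature-typing tranche LT-H1 «semiregularity consumers» (cell
`pub-hsemireg`): the scheme-level half of the chart identification in the assembly discharging
`Deformation.Hartshorne2010_localHilbertFunctor_isSmooth_of_subsingleton_normalH1` ([Hartshorne2010, Cor. 6.3]).

[Hartshorne2010, Thm. 6.2] is proved by reduction to the affine pieces of an open affine covering (proof of (b), p. 49:
«we can apply this result to each of the open affine pieces of an open affine covering of `X`»; §2, proof of Thm. 2.4,
p. 13: «The construction is compatible with localization, and the correspondence is natural»). For a closed
`Z = V(I₀) ⊆ X` in an arbitrary `k`-scheme `X`, an AFFINE open `U ⊆ X` with `A = Γ(X, U)`, `I = I₀(U)`, and a small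
extension `0 → J → C' → C → 0` in `Art_k` with `J = k · t`, this file identifies the sections over `U` of the tangent
sheaf of the local Hilbert functor — `H_{Z ∩ U}^U(k[J])` (`localHilbertFunctor.secOver`, `LocalHilbertFunctorSheaf.lean`),
with Schlessinger's group structure (`localHilbertFunctor.kerAddCommGroup`, `LocalHilbertFunctorFibreTorsorGeneral.lean`) —
with the normal vectors `Hom_A(I, A/I)`, naturally along inclusions `U' ≤ U` of affine opens:

* `secAlgebra X U` — the `k`-algebra structure on `A = Γ(X, U)` (structure map `k → Γ(X, 𝒪_X) → A`; a reducible
  definition, bound with `letI`), `resAlgHom X h : Γ(X, U) →ₐ[k] Γ(X, U')`;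
* `affineChart X U : openOver X U ≅ specOver k Γ(X, U)` — the chart `U ≅ Spec A` over `k` (Mathlib
  `IsAffineOpen.isoSpec`), `affineChart_naturality_left` (along `U' ≤ U` it is `Spec` of restriction),
  `comap_affineChart_inv` (it carries `I₀|_U` to `I~`);
* `secChart X I₀ U R : H_{Z ∩ U}^U(R) → H_{V(I)}^{Spec A}(R)` — pull-back of embedded deformations along the chart:
  bijective (`secChart_bijective`), natural in `R` (`secChart_isNatural`), hence additive on `k[J]` (`secChart_add`);
* `localHilbertFunctor.secKerSectionsEquiv X I₀ U p hI aug t … : H_{Z ∩ U}^U(k[J]) ≃+ (I →ₗ[A] A ⧸ I)` — the chart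
  followed by `LocalHilbertFunctorSpec.localHilbertFunctor.specKerSectionsEquiv` (Thm. 6.2 (a) affine, `J = k · t`);
* `localHilbertFunctor.secKerSectionsEquiv_naturality` — for affine `U' ≤ U`, restriction of sections
  (`localHilbertFunctor.resOver`) corresponds to restriction of normal vectors: `φ_{s|U'}(x|_{U'}) = (φ_s(x))|_{U'}`
  (via `secChart_resOver_ideal`: the chart ideal of `s|_{U'}` is the extension of that of `s`).

## What is NOT here

The normal-sheaf side `Γ(ι₀⁻¹U, 𝒩_{Z/X}) ≅ Hom_A(I, A/I)` (`HodgeTheory/NormalSheafAffineSections.lean`), the gluing over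
the basis of affine traces (`Modules/SheafHomOfAffineTraces.lean`), and any statement about `H¹`.

## References

* [Hartshorne2010] R. Hartshorne, *Deformation Theory*, GTM 257 (2010): §2 (Prop. 2.3, Thm. 2.4 and its proof,
  pp. 10–13), §6 (Thm. 6.2 and its proof, pp. 46–49; Cor. 6.3).
* [Schlessinger1968] M. Schlessinger, *Functors of Artin rings*, Trans. AMS 130 (1968), Lemma 2.10 and (2.17).
* [Hartshorne1977] R. Hartshorne, *Algebraic Geometry*, GTM 52 (1977), II Prop. 5.2, Cor. II.5.10.
-/

noncomputable section

-- as in `LocalHilbertFunctor.lean`: `(X ⊗ Spec R).left` unfolds to a pullback only at default transparency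
set_option backward.isDefEq.respectTransparency false -- `CategoryTheory.Monoidal.Cartesian.Over` itself

open CategoryTheory Limits MonoidalCategory AlgebraicGeometry Scheme.IdealSheafData TensorProduct IsLocalRing
open Literature.AlgebraicGeometry.FormalGeometry.FormalNeighbourhoodTower (specIdealSheaf)

universe u

namespace Literature.AlgebraicGeometry.Deformation

/-! ### The `k`-algebra `A = Γ(X, U)` and the chart `U ≅ Spec A` over `k` -/

section Chart

variable {k : Type u} [Field k] (X : Motives.SchemeOver k)

/-- The `k`-algebra structure on `A = Γ(X, U)` for a `k`-scheme `X`: the structure map `k = Γ(Spec k) → Γ(X, 𝒪_X) → Γ(X, U)`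
(«`X` corresponds to a `k`-algebra `B`», affine piece by affine piece). A reducible definition (data, not an instance;
bind with `letI`). [cite: Hartshorne2010, §2 p. 10 (Situation A: «`X` is affine … corresponds to a `k`-algebra `B`»)] -/
@[reducible] def secAlgebra (U : X.left.Opens) : Algebra k Γ(X.left, U) :=
  ((Scheme.ΓSpecIso (.of k)).inv ≫ X.hom.appTop ≫ X.left.presheaf.map (homOfLE (le_top : U ≤ ⊤)).op).hom.toAlgebra

/-- The structure map of `secAlgebra`. [cite: Hartshorne2010, §2 p. 10] -/
theorem secAlgebra_algebraMap (U : X.left.Opens) :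
    letI := secAlgebra X U
    algebraMap k Γ(X.left, U) =
      ((Scheme.ΓSpecIso (.of k)).inv ≫ X.hom.appTop ≫ X.left.presheaf.map (homOfLE (le_top : U ≤ ⊤)).op).hom :=
  rfl

/-- **Restriction `Γ(X, U) → Γ(X, U')` along `U' ≤ U` is a `k`-algebra map** for these structures. Definition with body.
[cite: Hartshorne2010, §2, proof of Thm. 2.4 (p. 13), «compatible with localization»] -/
def resAlgHom {U U' : X.left.Opens} (h : U' ≤ U) :
    letI := secAlgebra X U; letI := secAlgebra X U'
    Γ(X.left, U) →ₐ[k] Γ(X.left, U') :=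
  letI := secAlgebra X U; letI := secAlgebra X U'
  { (X.left.presheaf.map (homOfLE h).op).hom with
    commutes' := fun c => by
      change (((Scheme.ΓSpecIso (.of k)).inv ≫ X.hom.appTop ≫ X.left.presheaf.map (homOfLE (le_top : U ≤ ⊤)).op) ≫
          X.left.presheaf.map (homOfLE h).op).hom c =
        ((Scheme.ΓSpecIso (.of k)).inv ≫ X.hom.appTop ≫ X.left.presheaf.map (homOfLE (le_top : U' ≤ ⊤)).op).hom c
      rw [Category.assoc, Category.assoc, ← Functor.map_comp, ← op_comp, homOfLE_comp] }

/-- `resAlgHom` is the restriction map on elements. [cite: Hartshorne2010, §2, proof of Thm. 2.4 (p. 13)] -/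
@[simp]
theorem resAlgHom_apply {U U' : X.left.Opens} (h : U' ≤ U) (a : Γ(X.left, U)) :
    letI := secAlgebra X U; letI := secAlgebra X U'
    resAlgHom X h a = (X.left.presheaf.map (homOfLE h).op).hom a :=
  rfl

/-- `resAlgHom` as a ring map is the restriction map. [cite: Hartshorne2010, §2, proof of Thm. 2.4 (p. 13)] -/
theorem resAlgHom_toRingHom {U U' : X.left.Opens} (h : U' ≤ U) :
    letI := secAlgebra X U; letI := secAlgebra X U'
    (resAlgHom X h).toRingHom = (X.left.presheaf.map (homOfLE h).op).hom :=
  rfl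

variable (U : X.left.affineOpens)

/-- **The chart `U ≅ Spec Γ(X, U)` over `k`** for an affine open `U` of a `k`-scheme `X` (Mathlib `IsAffineOpen.isoSpec`,
which is `U.toSpecΓ`; it lies over `Spec k` by `Scheme.Opens.toSpecΓ_SpecMap_presheaf_map_top` and
`Scheme.toSpecΓ_naturality`). Definition with body. [cite: Hartshorne2010, §2 p. 10 (Situation A) and proof of Thm. 2.4
p. 13 («cover `X` with open affine subsets»)] [cite: Hartshorne1977, Cor. II.5.10 (p. 116)] -/
def affineChart : letI := secAlgebra X U.1; openOver X U.1 ≅ Motives.specOver k Γ(X.left, U) :=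
  letI := secAlgebra X U.1
  Over.isoMk U.2.isoSpec (by
    change U.1.toSpecΓ ≫ Spec.map (CommRingCat.ofHom (algebraMap k Γ(X.left, U))) = U.1.ι ≫ X.hom
    rw [secAlgebra_algebraMap, CommRingCat.ofHom_hom]
    simp only [Spec.map_comp, Category.assoc]
    rw [Scheme.Opens.toSpecΓ_SpecMap_presheaf_map_top_assoc, ← Scheme.toSpecΓ_naturality_assoc,
      toSpecΓ_SpecMap_ΓSpecIso_inv, Category.comp_id])

/-- The chart is `IsAffineOpen.isoSpec` on schemes. [cite: Hartshorne1977, Cor. II.5.10 (p. 116)] -/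
theorem affineChart_hom_left : (affineChart X U).hom.left = U.2.isoSpec.hom := rfl

/-- The inverse chart is `IsAffineOpen.isoSpec⁻¹` on schemes. [cite: Hartshorne1977, Cor. II.5.10 (p. 116)] -/
theorem affineChart_inv_left : (affineChart X U).inv.left = U.2.isoSpec.inv := rfl

variable {U} in
/-- **The charts are natural along `U' ≤ U`**: `Spec A' ≅ U' ⊆ U ≅ Spec A` is `Spec` of the restriction `A → A'`
(Mathlib `Scheme.Opens.toSpecΓ_SpecMap_presheaf_map`). [cite: Hartshorne2010, §2, proof of Thm. 2.4 (p. 13),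
«compatible with localization»] -/
theorem affineChart_naturality_left {U' : X.left.affineOpens} (h : U' ≤ U) :
    letI := secAlgebra X U.1; letI := secAlgebra X U'.1
    ((affineChart X U').inv ≫ openOverLE X h ≫ (affineChart X U).hom).left =
      Spec.map (CommRingCat.ofHom (resAlgHom X h).toRingHom) := by
  change U'.2.isoSpec.inv ≫ X.left.homOfLE h ≫ U.1.toSpecΓ = Spec.map (X.left.presheaf.map (homOfLE h).op)
  rw [← Scheme.Opens.toSpecΓ_SpecMap_presheaf_map U'.1 U.1 h, IsAffineOpen.isoSpec_inv_toSpecΓ_assoc]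
  rfl

/-- The global ideal of `I₀|_U` on the scheme `U`, read in `Γ(U, 𝒪_U) ≅ Γ(X, U)` (the computation of
`LocalHilbertFunctorCompleteIntersectionCharts.lean`, restated: Mathlib `ideal_comap_of_isOpenImmersion`).
[cite: Hartshorne1977, Cor. II.5.10 (p. 116)] [cite: Hartshorne2010, §2 p. 11 («compatible with localization»)] -/
theorem ideal_top_comap_ι (I₀ : X.left.IdealSheafData) :
    (I₀.comap U.1.ι).ideal ⟨⊤, isAffineOpen_top _⟩ = (I₀.ideal U).map U.1.topIso.inv.hom := by
  rw [ideal_comap_of_isOpenImmersion, Scheme.Opens.ι_appIso, Iso.refl_inv]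
  -- `Γ(U, ⊤) = Γ(X, U.ι(⊤))` holds by `rfl` only at default transparency (`Scheme.Opens.toScheme_presheaf_obj`)
  erw [Ideal.comap_id]
  exact (I₀.map_ideal' (U := ⟨U.1.ι ''ᵁ ⊤, (isAffineOpen_top _).image_of_isOpenImmersion U.1.ι⟩) (V := U)
    (eqToIso U.1.ι_image_top.symm).op.inv).symm

/-- `IsAffineOpen.isoSpec⁻¹ = Spec(Γ(U, ⊤) ≅ Γ(X, U)) ≫ (U.isoSpec)⁻¹`. [cite: Hartshorne1977, Cor. II.5.10 (p. 116)] -/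
theorem isoSpec_inv_eq : U.2.isoSpec.inv = Spec.map U.1.topIso.hom ≫ (U.1 : Scheme.{u}).isoSpec.inv := rfl

/-- **The chart carries the base point `I₀|_U` to `I~`, `I = I₀(U) ⊆ A`** (every quasi-coherent ideal sheaf on `Spec A`
is `I~` of its global sections). [cite: Hartshorne1977, Cor. II.5.10 (p. 116)] [cite: Hartshorne2010, §2 p. 10
(«`Y` is defined by an ideal `I ⊆ B`»)] -/
theorem comap_affineChart_inv (I₀ : X.left.IdealSheafData) :
    letI := secAlgebra X U.1
    (I₀.comap U.1.ι).comap (affineChart X U).inv.left = specIdealSheaf (.of Γ(X.left, U)) (I₀.ideal U) := by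
  haveI : IsAffine (U.1 : Scheme.{u}) := U.2
  rw [affineChart_inv_left, isoSpec_inv_eq, comap_comp]
  conv_lhs => rw [← specIdealSheaf_idealOfSpec ((I₀.comap U.1.ι).comap (U.1 : Scheme.{u}).isoSpec.inv),
    idealOfSpec_comap_isoSpec_inv, ideal_top_comap_ι]
  change (specIdealSheaf (.of Γ(↑U.1, ⊤)) ((I₀.ideal U).map U.1.topIso.inv.hom)).comap
      (Spec.map (CommRingCat.ofHom U.1.topIso.hom.hom)) = _
  rw [comap_specIdealSheaf_specMap, Ideal.map_map, ← CommRingCat.hom_comp, Iso.inv_hom_id, CommRingCat.hom_id,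
    Ideal.map_id]

end Chart

/-! ### The chart of sections `H_{Z ∩ U}^U(R) ≃ H_{V(I)}^{Spec A}(R)` -/

section SecChart

variable {k : Type u} [Field k] (X : Motives.SchemeOver k) (I₀ : X.left.IdealSheafData) (U : X.left.affineOpens)

/-- **Embedded deformations of `Z ∩ U ⊆ U` are embedded deformations of `V(I) ⊆ Spec A`**: pull-back along the chart
`Spec A ≅ U` (`localHilbertFunctor.pullbackMap`, with the base point rewritten by `comap_affineChart_inv`). Definition
with body. [cite: Hartshorne2010, §2 p. 10 (Situation A) and proof of Thm. 2.4 p. 13] -/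
def secChart (R : ArtAlg.{u} k) (s : localHilbertFunctor.secOver X I₀ R U.1) :
    letI := secAlgebra X U.1
    (localHilbertFunctor (Motives.specOver k Γ(X.left, U)) (specIdealSheaf (.of Γ(X.left, U)) (I₀.ideal U))).obj R :=
  letI := secAlgebra X U.1
  ⟨(localHilbertFunctor.pullbackMap (affineChart X U).inv (I₀.comap U.1.ι) R s).1,
    (localHilbertFunctor.pullbackMap (affineChart X U).inv (I₀.comap U.1.ι) R s).2.of_eq (comap_affineChart_inv X U I₀)⟩

/-- The underlying ideal sheaf of the charted section: the pull-back along `(chart⁻¹)_R`.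
[cite: Hartshorne2010, §2 p. 11 («compatible with localization»)] -/
@[simp]
theorem secChart_val (R : ArtAlg.{u} k) (s : localHilbertFunctor.secOver X I₀ R U.1) :
    (secChart X I₀ U R s).1 = s.1.comap ((affineChart X U).inv ▷ R.specOver).left :=
  rfl

/-- The chart of sections is natural in `R` («the correspondence is natural»). [cite: Hartshorne2010, §2 p. 13] -/
theorem secChart_isNatural :
    letI := secAlgebra X U.1
    ArtinFunctor.IsNatural (localHilbertFunctor (openOver X U.1) (I₀.comap U.1.ι))
      (localHilbertFunctor (Motives.specOver k Γ(X.left, U)) (specIdealSheaf (.of Γ(X.left, U)) (I₀.ideal U)))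
      (secChart X I₀ U) := fun R S φ s => by
  letI := secAlgebra X U.1
  apply Subtype.ext
  change (s.1.comap (openOver X U.1 ◁ ArtAlg.specOverMap φ).left).comap ((affineChart X U).inv ▷ S.specOver).left =
    (s.1.comap ((affineChart X U).inv ▷ R.specOver).left).comap
      (Motives.specOver k Γ(X.left, U) ◁ ArtAlg.specOverMap φ).left
  rw [← comap_comp, ← comap_comp, ← Over.comp_left, ← Over.comp_left, whisker_exchange]

/-- **The chart of sections is a bijection** (pull-back along an isomorphism; `pullbackMap_bijective_of_iso`).
[cite: Hartshorne2010, §2 p. 10 (Situation A) and proof of Thm. 2.4 p. 13] -/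
theorem secChart_bijective (R : ArtAlg.{u} k) : Function.Bijective (secChart X I₀ U R) := by
  have h := localHilbertFunctor.pullbackMap_bijective_of_iso (affineChart X U).symm (I₀.comap U.1.ι) R
  refine ⟨fun s s' hss' => h.1 (Subtype.ext (congrArg Subtype.val hss' :)), fun w => ?_⟩
  obtain ⟨s, hs⟩ := h.2 ⟨w.1, w.2.of_eq (comap_affineChart_inv X U I₀).symm⟩
  exact ⟨s, Subtype.ext (congrArg Subtype.val hs :)⟩

variable {R₀ R₁ : ArtAlg.{u} k} (p : R₁ →ₐ[k] R₀) (hI : RingHom.ker p * maximalIdeal R₁ = ⊥) (aug : ↥R₁ →ₐ[k] k)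

/-- **The chart of sections is additive on `k[J]`** for Schlessinger's group structures (a natural map of functors of
Artin rings is additive: the tree's `ArtinFunctor.nat_kerAdd` with `kerAdd_eq_add`, as in
`localHilbertFunctor.pullbackMap_add`). [cite: Schlessinger1968, Lemma 2.10 and (2.17), pp. 212–213]
[cite: Hartshorne2010, §6, proof of Thm. 6.2 (a), p. 47] -/
theorem secChart_add (v w : localHilbertFunctor.secOver X I₀ (ArtAlg.sqZeroKer p hI) U.1) :
    letI := localHilbertFunctor.kerAddCommGroup (openOver X U.1) (I₀.comap U.1.ι) p hI aug
    letI := secAlgebra X U.1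
    letI := LocalHilbertFunctorSpec.localHilbertFunctor.specKerAddCommGroup k Γ(X.left, U) (I₀.ideal U) p hI aug
    secChart X I₀ U _ (v + w) = secChart X I₀ U _ v + secChart X I₀ U _ w := by
  letI := localHilbertFunctor.kerAddCommGroup (openOver X U.1) (I₀.comap U.1.ι) p hI aug
  letI := secAlgebra X U.1
  letI := LocalHilbertFunctorSpec.localHilbertFunctor.specKerAddCommGroup k Γ(X.left, U) (I₀.ideal U) p hI aug
  rw [← ArtinFunctor.kerAdd_eq_add, ← ArtinFunctor.kerAdd_eq_add]
  exact ArtinFunctor.nat_kerAdd (secChart X I₀ U) (secChart_isNatural X I₀ U) _ _ _ _ p hI aug _ _ v w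

/-- The chart of sections on `k[J]` as an additive bijection. Definition with body.
[cite: Hartshorne2010, §6, proof of Thm. 6.2 (a), p. 47] [cite: Schlessinger1968, Lemma 2.10 and (2.17), pp. 212–213] -/
def secChartAddEquiv :
    letI := localHilbertFunctor.kerAddCommGroup (openOver X U.1) (I₀.comap U.1.ι) p hI aug
    letI := secAlgebra X U.1
    letI := LocalHilbertFunctorSpec.localHilbertFunctor.specKerAddCommGroup k Γ(X.left, U) (I₀.ideal U) p hI aug
    localHilbertFunctor.secOver X I₀ (ArtAlg.sqZeroKer p hI) U.1 ≃+
      (localHilbertFunctor (Motives.specOver k Γ(X.left, U)) (specIdealSheaf (.of Γ(X.left, U)) (I₀.ideal U))).obj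
        (ArtAlg.sqZeroKer p hI) :=
  letI := localHilbertFunctor.kerAddCommGroup (openOver X U.1) (I₀.comap U.1.ι) p hI aug
  letI := secAlgebra X U.1
  letI := LocalHilbertFunctorSpec.localHilbertFunctor.specKerAddCommGroup k Γ(X.left, U) (I₀.ideal U) p hI aug
  { toFun := secChart X I₀ U (ArtAlg.sqZeroKer p hI)
    invFun := Function.surjInv (secChart_bijective X I₀ U (ArtAlg.sqZeroKer p hI)).2
    left_inv := Function.leftInverse_surjInv (secChart_bijective X I₀ U (ArtAlg.sqZeroKer p hI))
    right_inv := Function.rightInverse_surjInv (secChart_bijective X I₀ U (ArtAlg.sqZeroKer p hI)).2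
    map_add' := secChart_add X I₀ U p hI aug }

/-- `secChartAddEquiv` is `secChart` on elements. [cite: Hartshorne2010, §6, proof of Thm. 6.2 (a), p. 47] -/
theorem secChartAddEquiv_apply (v : localHilbertFunctor.secOver X I₀ (ArtAlg.sqZeroKer p hI) U.1) :
    letI := localHilbertFunctor.kerAddCommGroup (openOver X U.1) (I₀.comap U.1.ι) p hI aug
    letI := secAlgebra X U.1
    letI := LocalHilbertFunctorSpec.localHilbertFunctor.specKerAddCommGroup k Γ(X.left, U) (I₀.ideal U) p hI aug
    secChartAddEquiv X I₀ U p hI aug v = secChart X I₀ U _ v :=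
  rfl

/-! ### `H_{Z ∩ U}^U(k[J]) ≃+ Hom_A(I(U), A/I(U))` -/

variable (t : ↥(ArtAlg.kerSubmodule p)) (ht : (t : ↥R₁) ≠ 0) (hts : ∀ j : ↥(ArtAlg.kerSubmodule p), ∃ b : k, j = b • t)

/-- **Sections of the tangent sheaf over an affine open are normal vectors**: for `Z = V(I₀) ⊆ X`, `U ⊆ X` affine open
with `A = Γ(X, U)`, `I = I₀(U)`, and a small extension with kernel `J = k · t`,
`H_{Z ∩ U}^U(k[J]) ≃+ Hom_A(I, A/I)` — the chart `U ≅ Spec A` followed by the affine identification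
(`LocalHilbertFunctorSpec.localHilbertFunctor.specKerSectionsEquiv`: Thm. 2.4 affine and `k[ε] ≅ k[J]`); the group
structure on the left is `localHilbertFunctor.kerAddCommGroup` of `LocalHilbertFunctorFibreTorsorGeneral.lean`
(«the set of such extensions is a principal homogeneous space under … `H⁰(Y₀, 𝒩₀ ⊗_k J)`», computed on an affine piece).
Definition with body. [cite: Hartshorne2010, Thm. 6.2 (a) and its proof, pp. 46–47, with Thm. 2.4 (p. 12) and §2 p. 13]
[cite: Schlessinger1968, Lemma 2.10 and (2.17), pp. 212–213] -/
def localHilbertFunctor.secKerSectionsEquiv :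
    letI := localHilbertFunctor.kerAddCommGroup (openOver X U.1) (I₀.comap U.1.ι) p hI aug
    localHilbertFunctor.secOver X I₀ (ArtAlg.sqZeroKer p hI) U.1 ≃+
      (↥(I₀.ideal U) →ₗ[Γ(X.left, U)] Γ(X.left, U) ⧸ I₀.ideal U) :=
  letI := localHilbertFunctor.kerAddCommGroup (openOver X U.1) (I₀.comap U.1.ι) p hI aug
  letI := secAlgebra X U.1
  letI := LocalHilbertFunctorSpec.localHilbertFunctor.specKerAddCommGroup k Γ(X.left, U) (I₀.ideal U) p hI aug
  (secChartAddEquiv X I₀ U p hI aug).trans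
    (LocalHilbertFunctorSpec.localHilbertFunctor.specKerSectionsEquiv k Γ(X.left, U) (I₀.ideal U) p hI aug t ht hts)

/-- On elements the identification is the affine one applied to the charted section (unfolding lemma; proved by
rewriting, never by unfolding the two functors against each other). [cite: Hartshorne2010, Thm. 6.2 (a) proof, pp. 46–47] -/
theorem localHilbertFunctor.secKerSectionsEquiv_apply (s : localHilbertFunctor.secOver X I₀ (ArtAlg.sqZeroKer p hI) U.1) :
    letI := localHilbertFunctor.kerAddCommGroup (openOver X U.1) (I₀.comap U.1.ι) p hI aug
    letI := secAlgebra X U.1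
    letI := LocalHilbertFunctorSpec.localHilbertFunctor.specKerAddCommGroup k Γ(X.left, U) (I₀.ideal U) p hI aug
    localHilbertFunctor.secKerSectionsEquiv X I₀ U p hI aug t ht hts s =
      LocalHilbertFunctorSpec.localHilbertFunctor.specKerSectionsEquiv k Γ(X.left, U) (I₀.ideal U) p hI aug t ht hts
        (secChart X I₀ U _ s) := by
  letI := localHilbertFunctor.kerAddCommGroup (openOver X U.1) (I₀.comap U.1.ι) p hI aug
  letI := secAlgebra X U.1
  letI := LocalHilbertFunctorSpec.localHilbertFunctor.specKerAddCommGroup k Γ(X.left, U) (I₀.ideal U) p hI aug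
  unfold localHilbertFunctor.secKerSectionsEquiv
  rw [AddEquiv.trans_apply, secChartAddEquiv_apply]

/-- **Membership form** (Prop. 2.3 on the affine piece): `φ_s(x) = ȳ ⟺ x ⊗ 1 + y ⊗ t ∈ I'_s`, `I'_s ⊆ A ⊗_k k[J]` the
chart ideal of the section `s`. [cite: Hartshorne2010, Prop. 2.3 (proof, p. 11) and Thm. 6.2 (a) proof (pp. 46–47)] -/
theorem localHilbertFunctor.secKerSectionsEquiv_apply_eq_iff
    (s : localHilbertFunctor.secOver X I₀ (ArtAlg.sqZeroKer p hI) U.1) (x : ↥(I₀.ideal U)) (y : Γ(X.left, U)) :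
    letI := localHilbertFunctor.kerAddCommGroup (openOver X U.1) (I₀.comap U.1.ι) p hI aug
    letI := secAlgebra X U.1
    localHilbertFunctor.secKerSectionsEquiv X I₀ U p hI aug t ht hts s x = Ideal.Quotient.mk (I₀.ideal U) y ↔
      (x : Γ(X.left, U)) ⊗ₜ[k] (1 : (ArtAlg.sqZeroKer p hI : Type u)) +
          y ⊗ₜ[k] (ArtAlg.kerToSqZeroKer p hI t : (ArtAlg.sqZeroKer p hI : Type u)) ∈
        ((localHilbertFunctor.specObjEquiv k Γ(X.left, U) (ArtAlg.sqZeroKer p hI) (I₀.ideal U))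
          (secChart X I₀ U _ s)).1 := by
  letI := localHilbertFunctor.kerAddCommGroup (openOver X U.1) (I₀.comap U.1.ι) p hI aug
  letI := secAlgebra X U.1
  rw [localHilbertFunctor.secKerSectionsEquiv_apply]
  exact LocalHilbertFunctorSpec.localHilbertFunctor.specKerSectionsEquiv_apply_eq_iff k Γ(X.left, U) (I₀.ideal U) p hI
    aug t ht hts _ x y

end SecChart

/-! ### Naturality along `U' ≤ U` («compatible with localization») -/

section Naturality

variable {k : Type u} [Field k] (X : Motives.SchemeOver k) (I₀ : X.left.IdealSheafData) {U U' : X.left.affineOpens}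
  (h : U' ≤ U)

/-- The restricted-then-charted section and the charted section differ by the base change of
`Spec A' ≅ U' ⊆ U ≅ Spec A`: equality of the underlying ideal sheaves. [cite: Hartshorne2010, §2 p. 13 («compatible with
localization»)] -/
theorem secChart_resOver_val (R : ArtAlg.{u} k) (s : localHilbertFunctor.secOver X I₀ R U.1) :
    letI := secAlgebra X U.1; letI := secAlgebra X U'.1
    (secChart X I₀ U' R (localHilbertFunctor.resOver h s)).1 =
      (secChart X I₀ U R s).1.comap
        ((((affineChart X U').inv ≫ openOverLE X h ≫ (affineChart X U).hom) ▷ R.specOver).left) := by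
  rw [secChart_val, secChart_val, localHilbertFunctor.resOver_val, ← comap_comp, ← comap_comp, ← Over.comp_left,
    ← Over.comp_left, ← comp_whiskerRight, ← comp_whiskerRight, Category.assoc, Category.assoc, Iso.hom_inv_id,
    Category.comp_id]

/-- **Restriction of sections is extension of chart ideals**: for affine `U' ≤ U` and `s ∈ H_{Z ∩ U}^U(R)`, the chart
ideal `I'_{s|U'} ⊆ A' ⊗_k R` is `(ρ ⊗ R)(I'_s) · (A' ⊗ R)`, `ρ : A → A'` the restriction (the ideal sheaf of the embedded
deformation is quasi-coherent). [cite: Hartshorne2010, §2 p. 13 («The construction is compatible with localization»)]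
[cite: Hartshorne1977, II Prop. 5.2 (e)] -/
theorem secChart_resOver_ideal (R : ArtAlg.{u} k) (s : localHilbertFunctor.secOver X I₀ R U.1) :
    letI := secAlgebra X U.1; letI := secAlgebra X U'.1
    ((localHilbertFunctor.specObjEquiv k Γ(X.left, U') R (I₀.ideal U')) (secChart X I₀ U' R (localHilbertFunctor.resOver h s))).1 =
      ((localHilbertFunctor.specObjEquiv k Γ(X.left, U) R (I₀.ideal U)) (secChart X I₀ U R s)).1.map
        (Algebra.TensorProduct.map (resAlgHom X h) (AlgHom.id k (R : Type u))).toRingHom := by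
  letI := secAlgebra X U.1; letI := secAlgebra X U'.1
  rw [specObjEquiv_val, specObjEquiv_val, secChart_resOver_val,
    idealOfSpec_comap_whiskerRight_left k Γ(X.left, U) Γ(X.left, U') (resAlgHom X h) _ (affineChart_naturality_left X h) R]

variable {R₀ R₁ : ArtAlg.{u} k} (p : R₁ →ₐ[k] R₀) (hI : RingHom.ker p * maximalIdeal R₁ = ⊥) (aug : ↥R₁ →ₐ[k] k)
variable (t : ↥(ArtAlg.kerSubmodule p)) (ht : (t : ↥R₁) ≠ 0) (hts : ∀ j : ↥(ArtAlg.kerSubmodule p), ∃ b : k, j = b • t)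

/-- `I₀(U)|_{U'} ⊆ I₀(U')`. [cite: Hartshorne2010, §2, proof of Thm. 2.4 (p. 13)] -/
theorem res_mem_ideal (x : ↥(I₀.ideal U)) :
    (X.left.presheaf.map (homOfLE h).op).hom (x : Γ(X.left, U)) ∈ I₀.ideal U' :=
  Scheme.IdealSheafData.ideal_le_comap_ideal I₀ h x.2

/-- The restriction `I₀(U) → I₀(U')` of sections of the ideal sheaf along affine `U' ≤ U` (for a kernel `I₀ = ι₀.ker` this
is `HodgeTheory.resIdeal ι₀ h` of `NormalSheafAffineSections.lean`, by `rfl`). Definition with body.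
[cite: Hartshorne2010, §2, proof of Thm. 2.4 (p. 13), «compatible with localization»] -/
def secResIdeal (x : ↥(I₀.ideal U)) : ↥(I₀.ideal U') :=
  ⟨(X.left.presheaf.map (homOfLE h).op).hom (x : Γ(X.left, U)), res_mem_ideal X I₀ h x⟩

/-- Unfolding `secResIdeal`. [cite: Hartshorne2010, §2, proof of Thm. 2.4 (p. 13)] -/
@[simp]
theorem coe_secResIdeal (x : ↥(I₀.ideal U)) :
    (secResIdeal X I₀ h x : Γ(X.left, U')) = (X.left.presheaf.map (homOfLE h).op).hom (x : Γ(X.left, U)) :=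
  rfl

/-- The quotient map `A ⧸ I₀(U) → A' ⧸ I₀(U')` induced by restriction along affine `U' ≤ U` (for `I₀ = ι₀.ker` this is
`HodgeTheory.resQuot ι₀ h`, by `rfl`). Definition with body. [cite: Hartshorne2010, §2, proof of Thm. 2.4 (p. 13)] -/
def secResQuot : Γ(X.left, U) ⧸ I₀.ideal U →+* Γ(X.left, U') ⧸ I₀.ideal U' :=
  Ideal.quotientMap (I₀.ideal U') (X.left.presheaf.map (homOfLE h).op).hom
    (Scheme.IdealSheafData.ideal_le_comap_ideal I₀ h)

/-- `secResQuot (ā) = (a|_{U'})‾`. [cite: Hartshorne2010, §2, proof of Thm. 2.4 (p. 13)] -/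
@[simp]
theorem secResQuot_mk (a : Γ(X.left, U)) :
    secResQuot X I₀ h (Ideal.Quotient.mk (I₀.ideal U) a) =
      Ideal.Quotient.mk (I₀.ideal U') ((X.left.presheaf.map (homOfLE h).op).hom a) :=
  Ideal.quotientMap_mk

/-- **Naturality of `H_{Z ∩ U}^U(k[J]) ≅ Hom_A(I(U), A/I(U))` along affine `U' ≤ U`** — pointwise form: if `φ_s(x) = ȳ`
then `φ_{s|U'}(x|_{U'}) = (y|_{U'})‾`. [cite: Hartshorne2010, §2, proof of Thm. 2.4 (p. 13): «The construction is
compatible with localization, and the correspondence is natural»] [cite: Hartshorne2010, §6, proof of Thm. 6.2, p. 49] -/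
theorem localHilbertFunctor.secKerSectionsEquiv_resOver_of_eq
    (s : localHilbertFunctor.secOver X I₀ (ArtAlg.sqZeroKer p hI) U.1) (x : ↥(I₀.ideal U)) (y : Γ(X.left, U))
    (hxy : letI := localHilbertFunctor.kerAddCommGroup (openOver X U.1) (I₀.comap U.1.ι) p hI aug
      localHilbertFunctor.secKerSectionsEquiv X I₀ U p hI aug t ht hts s x = Ideal.Quotient.mk (I₀.ideal U) y) :
    letI := localHilbertFunctor.kerAddCommGroup (openOver X U'.1) (I₀.comap U'.1.ι) p hI aug
    localHilbertFunctor.secKerSectionsEquiv X I₀ U' p hI aug t ht hts (localHilbertFunctor.resOver h s)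
        (secResIdeal X I₀ h x) =
      Ideal.Quotient.mk (I₀.ideal U') ((X.left.presheaf.map (homOfLE h).op).hom y) := by
  letI := secAlgebra X U.1; letI := secAlgebra X U'.1
  letI := localHilbertFunctor.kerAddCommGroup (openOver X U.1) (I₀.comap U.1.ι) p hI aug
  letI := localHilbertFunctor.kerAddCommGroup (openOver X U'.1) (I₀.comap U'.1.ι) p hI aug
  rw [localHilbertFunctor.secKerSectionsEquiv_apply] at hxy
  rw [localHilbertFunctor.secKerSectionsEquiv_apply]
  exact LocalHilbertFunctorSpec.localHilbertFunctor.specKerSectionsEquiv_naturality k Γ(X.left, U) (I₀.ideal U) p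
    hI aug t ht hts (I₀.ideal U') (resAlgHom X h) (secChart X I₀ U _ s)
    (secChart X I₀ U' _ (localHilbertFunctor.resOver h s)) (le_of_eq (secChart_resOver_ideal X I₀ h _ s).symm) x
    (res_mem_ideal X I₀ h x) y hxy

/-- **Naturality of `H_{Z ∩ U}^U(k[J]) ≅ Hom_A(I(U), A/I(U))` along affine `U' ≤ U`**: restriction of sections of the
tangent sheaf (`localHilbertFunctor.resOver`) corresponds to restriction of normal vectors,
`φ_{s|U'}(x|_{U'}) = (φ_s(x))|_{U'}` in `A'/I(U')`. [cite: Hartshorne2010, §2, proof of Thm. 2.4 (p. 13): «The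
construction is compatible with localization, and the correspondence is natural»] [cite: Hartshorne2010, §6, proof of
Thm. 6.2, p. 49 («it glues together on the overlaps»)] -/
theorem localHilbertFunctor.secKerSectionsEquiv_naturality
    (s : localHilbertFunctor.secOver X I₀ (ArtAlg.sqZeroKer p hI) U.1) (x : ↥(I₀.ideal U)) :
    letI := localHilbertFunctor.kerAddCommGroup (openOver X U.1) (I₀.comap U.1.ι) p hI aug
    letI := localHilbertFunctor.kerAddCommGroup (openOver X U'.1) (I₀.comap U'.1.ι) p hI aug
    localHilbertFunctor.secKerSectionsEquiv X I₀ U' p hI aug t ht hts (localHilbertFunctor.resOver h s)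
        (secResIdeal X I₀ h x) =
      secResQuot X I₀ h (localHilbertFunctor.secKerSectionsEquiv X I₀ U p hI aug t ht hts s x) := by
  letI := localHilbertFunctor.kerAddCommGroup (openOver X U.1) (I₀.comap U.1.ι) p hI aug
  letI := localHilbertFunctor.kerAddCommGroup (openOver X U'.1) (I₀.comap U'.1.ι) p hI aug
  obtain ⟨y, hy⟩ := Ideal.Quotient.mk_surjective (localHilbertFunctor.secKerSectionsEquiv X I₀ U p hI aug t ht hts s x)
  have h1 := localHilbertFunctor.secKerSectionsEquiv_resOver_of_eq X I₀ h p hI aug t ht hts s x y hy.symm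
  exact h1.trans ((secResQuot_mk X I₀ h y).symm.trans (congrArg (secResQuot X I₀ h) hy))

end Naturality

end Literature.AlgebraicGeometry.Deformation

end
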